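import Literature.Combinatorics.Optimization.SosConeSemidefiniteExtensionDegree
import Literature.Algebra.Polynomial.NonnegQuadraticSumOfSquares
import Literature.Algebra.Polynomial.UnivariateNonnegSumOfSquares
import HarnessLib

/-!
# The semidefinite extension degree of `P_{n,2}` and `P_{1,2d}` (Averkov 2019, Cor. 12 via Hilbert's Thm. 10)

G. Averkov, *Optimal size of linear matrix inequalities in semidefinite approaches to polynomial
optimization*, SIAM J. Appl. Algebra Geom. **3** (2019) 128–151 = arXiv:1806.08656 [cite: Averkov2019]
(held text `paper:arxiv-1806.08656`, arXiv page numbering), p06, verbatim: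

"In view of Corollary 4, to determine `sxd(P_{n,2d})`, it suffices to combine a classical result of
Hilbert with a recent result of Scheiderer.
**Theorem 10** (Hilbert [Hilbert 1888]). `Σ_{n,2d} ≠ P_{n,2d} ⟺ n, d ≥ 2, (n,d) ≠ (2,2)`.
**Theorem 11** (Scheiderer [2018]). If `n ≥ 2, d ≥ 2` and `(n,d) ≠ (2,2)`, then `P_{n,2d}` has no
semidefinite extended formulation.
Directly combining Corollary 4, Theorem 10 and Theorem 11, we get
**Corollary 12.** `sxd(P_{n,2d}) = sxc(P_{n,2d}) = ∞` if `n, d ≥ 2, (n,d) ≠ (2,2)`; `= binom(n+d, n)`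
otherwise."
and the proof (p13): "Otherwise, by Theorem 10 of Hilbert, `P_{n,2d} = Σ_{n,2d}`. Thus
`sxd(P_{n,2d}) = sxc(P_{n,2d}) = binom(n+d,n)` follows using Corollary 4."

This file PROVES the two classical finite cases of Corollary 12 in the vocabulary of
`SosConeSemidefiniteExtensionDegree.lean` (`sosPolynomialCone n d = Σ_{n,2d}`,
`nonnegPolynomialCone n D X = P_{n,D}(X)`, `HasBlockPsdLift`, `HasPsdLift`), exactly as printed —
Hilbert's equality, then Corollary 4 (`isLeast_blockSize_hasBlockPsdLift_sosPolynomialCone`):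

* `d = 1`, every `n` (quadratic polynomials): Hilbert's equality `Σ_{n,2} = P_{n,2}` is the tree's
  `NonnegQuadraticSumOfSquares.isSumSq_of_nonneg_of_totalDegree_le_two` (Laurent 2008, Lemma 3.6);
  here `sosPolynomialCone_one_eq_nonnegPolynomialCone` and
  **`isLeast_blockSize_hasBlockPsdLift_nonnegPolynomialCone_two`**: `sxd(P_{n,2}) = n + 1`
  (`binom(n+1, n) = n + 1`), with the one-block form `isLeast_size_hasPsdLift_nonnegPolynomialCone_two`
  (`sxc(P_{n,2}) = n + 1`).
* `n = 1`, every `d` (univariate polynomials): Hilbert's equality `Σ_{1,2d} = P_{1,2d}` is the tree's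
  `UnivariateNonnegSumOfSquares.isSumSq_of_nonneg` (for `ℝ[X]`), transported along
  `MvPolynomial.uniqueAlgEquiv ℝ (Fin 1) : ℝ[x₀] ≃ₐ ℝ[X]`; here
  `sosPolynomialCone_univariate_eq_nonnegPolynomialCone` and
  **`isLeast_blockSize_hasBlockPsdLift_nonnegPolynomialCone_univariate`**: `sxd(P_{1,2d}) = d + 1`,
  `isLeast_size_hasPsdLift_nonnegPolynomialCone_univariate`. (The coefficient-vector form of this
  case is `isLeast_blockSize_hasBlockPsdLift_nonnegPolyCoeff` in
  `NeighborlyObstructionBlockPsdLifts.lean`; the present statement is the one in Averkov's cone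
  vocabulary.)

Also: `mem_sosPolynomialCone_of_isSumSq` / `isSumSq_of_mem_sosPolynomialCone` — the bridge
between Mathlib's `IsSumSq` and `Σ_{n,2d}`.

WHAT IS NOT HERE: the case `(n, d) = (2, 2)` of Theorem 10 (ternary quartic forms; Hilbert 1888,
not in the tree) and Scheiderer's Theorem 11 (`sxd(P_{n,2d}) = ∞` otherwise) — a deep negative
result; hence Corollary 12 is typed only in its two elementary finite cases. Everything here is
proved; no named fact.
-/

noncomputable section

open MvPolynomial

namespace Literature.Combinatorics.Optimization

open Literature.Algebra.Polynomial.NonnegQuadraticSumOfSquares (isSumSq_of_nonneg_of_totalDegree_le_two)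
open Literature.Algebra.Polynomial.GramMatrixMethod (exists_sum_mul_self_eq_of_isSumSq_of_totalDegree_le)

/-! ### `Σ_{n,2d}` and Mathlib's `IsSumSq` -/

/-- A sum of squares (Mathlib's `IsSumSq`) of total degree `≤ 2d` lies in `Σ_{n,2d}` ("`f` is called
SOS if `f = f_1² + ⋯ + f_r²` for finitely many polynomials"). [cite: Averkov2019, §1.2 (p03)] -/
theorem mem_sosPolynomialCone_of_isSumSq {n d : ℕ} {p : MvPolynomial (Fin n) ℝ} (hp : IsSumSq p)
    (hd : p.totalDegree ≤ 2 * d) : p ∈ sosPolynomialCone n d := by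
  obtain ⟨m, u, hu, -⟩ := exists_sum_mul_self_eq_of_isSumSq_of_totalDegree_le hp hd
  exact ⟨hd, m, u, by rw [hu]; exact Finset.sum_congr rfl fun j _ => (pow_two (u j)).symm⟩

/-- Conversely every element of `Σ_{n,2d}` is a sum of squares. [cite: Averkov2019, §1.2 (p03)] -/
theorem isSumSq_of_mem_sosPolynomialCone {n d : ℕ} {p : MvPolynomial (Fin n) ℝ}
    (hp : p ∈ sosPolynomialCone n d) : IsSumSq p := by
  obtain ⟨-, m, u, rfl⟩ := hp
  exact IsSumSq.sum_sq _ _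

/-- `Σ_{n,2d} = {f : deg f ≤ 2d, f SOS}` with Mathlib's `IsSumSq`. [cite: Averkov2019, §1.2 (p03)] -/
theorem mem_sosPolynomialCone_iff_isSumSq {n d : ℕ} {p : MvPolynomial (Fin n) ℝ} :
    p ∈ sosPolynomialCone n d ↔ p.totalDegree ≤ 2 * d ∧ IsSumSq p :=
  ⟨fun h => ⟨h.1, isSumSq_of_mem_sosPolynomialCone h⟩,
    fun h => mem_sosPolynomialCone_of_isSumSq h.2 h.1⟩

/-! ### The case `d = 1`: quadratic polynomials in `n` variables -/

/-- **Hilbert's theorem (Averkov's Theorem 10), the case `d = 1`: `Σ_{n,2} = P_{n,2}`** — a real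
polynomial of degree `≤ 2` in `n` variables nonnegative on `ℝⁿ` is a sum of squares (Laurent 2008,
Lemma 3.6, in the tree). [cite: Averkov2019, Thm. 10 (p06)] -/
theorem sosPolynomialCone_one_eq_nonnegPolynomialCone (n : ℕ) :
    sosPolynomialCone n 1 = nonnegPolynomialCone n 2 Set.univ := by
  classical
  refine Set.Subset.antisymm (sosPolynomialCone_subset_nonnegPolynomialCone n 1 Set.univ) ?_
  rintro p ⟨hdeg, hnn⟩
  exact mem_sosPolynomialCone_of_isSumSq
    (isSumSq_of_nonneg_of_totalDegree_le_two hdeg fun x => hnn x (Set.mem_univ x)) (by omega)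

/-- **Averkov 2019, Corollary 12, the case `d = 1`: `sxd(P_{n,2}) = binom(n+1, n) = n + 1`** — the
least block size `k` for which the cone of nonnegative quadratic polynomials in `n` variables has an
`(S^k_+)^m`-lift for some `m` is `n + 1` (Hilbert's equality `P_{n,2} = Σ_{n,2}` and Corollary 4).
[cite: Averkov2019, Cor. 12 (p06), proof (p13)] -/
theorem isLeast_blockSize_hasBlockPsdLift_nonnegPolynomialCone_two (n : ℕ) :
    IsLeast {k : ℕ | ∃ m : ℕ, HasBlockPsdLift (nonnegPolynomialCone n 2 Set.univ) k m} (n + 1) := by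
  have h := isLeast_blockSize_hasBlockPsdLift_sosPolynomialCone n 1
  rwa [sosPolynomialCone_one_eq_nonnegPolynomialCone, Nat.choose_succ_self_right] at h

/-- **Averkov 2019, Corollary 12, the case `d = 1`, one block: `sxc(P_{n,2}) = n + 1`** — the least
size of a single LMI lifting `P_{n,2}`. [cite: Averkov2019, Cor. 12 (p06), proof (p13)] -/
theorem isLeast_size_hasPsdLift_nonnegPolynomialCone_two (n : ℕ) :
    IsLeast {k : ℕ | HasPsdLift (nonnegPolynomialCone n 2 Set.univ) k} (n + 1) := by
  have h := isLeast_size_hasPsdLift_sosPolynomialCone n 1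
  rwa [sosPolynomialCone_one_eq_nonnegPolynomialCone, Nat.choose_succ_self_right] at h

/-! ### The case `n = 1`: univariate polynomials of degree `2d` -/

/-- Evaluating the univariate polynomial attached to `p : ℝ[x₀]` at `v 0` is evaluating `p` at `v`.
[folklore] -/
private theorem eval_uniqueAlgEquiv (p : MvPolynomial (Fin 1) ℝ) (v : Fin 1 → ℝ) :
    Polynomial.eval (v 0) (MvPolynomial.uniqueAlgEquiv ℝ (Fin 1) p) = MvPolynomial.eval v p := by
  rw [← Polynomial.eval₂_id, ← MvPolynomial.eval₂_id, ← Fin.default_eq_zero,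
    MvPolynomial.eval₂_uniqueAlgEquiv]

/-- A ring homomorphism maps sums of squares to sums of squares. [folklore] -/
private theorem isSumSq_map {R S : Type*} [CommSemiring R] [CommSemiring S] (φ : R →+* S)
    {p : R} (hp : IsSumSq p) : IsSumSq (φ p) := by
  induction hp with
  | zero => rw [map_zero]; exact IsSumSq.zero
  | sq_add a hs ih => rw [map_add, map_mul]; exact IsSumSq.sq_add _ ih

/-- **Hilbert's theorem (Averkov's Theorem 10), the case `n = 1`: `Σ_{1,2d} = P_{1,2d}`** — a real
univariate polynomial of degree `≤ 2d` nonnegative on `ℝ` is a sum of squares (the tree's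
`UnivariateNonnegSumOfSquares.isSumSq_of_nonneg`, transported along `ℝ[x₀] ≃ₐ ℝ[X]`).
[cite: Averkov2019, Thm. 10 (p06)] -/
theorem sosPolynomialCone_univariate_eq_nonnegPolynomialCone (d : ℕ) :
    sosPolynomialCone 1 d = nonnegPolynomialCone 1 (2 * d) Set.univ := by
  refine Set.Subset.antisymm (sosPolynomialCone_subset_nonnegPolynomialCone 1 d Set.univ) ?_
  rintro p ⟨hdeg, hnn⟩
  refine mem_sosPolynomialCone_of_isSumSq ?_ hdeg
  set e := MvPolynomial.uniqueAlgEquiv ℝ (Fin 1) with he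
  have hq : IsSumSq (e p) := by
    refine Literature.Algebra.Polynomial.UnivariateNonnegSumOfSquares.isSumSq_of_nonneg fun t => ?_
    have h := eval_uniqueAlgEquiv p (fun _ => t)
    rw [he]
    rw [h]
    exact hnn _ (Set.mem_univ _)
  have hback : IsSumSq (e.symm (e p)) := isSumSq_map (e.symm : Polynomial ℝ →+* MvPolynomial (Fin 1) ℝ) hq
  rwa [AlgEquiv.symm_apply_apply] at hback

/-- **Averkov 2019, Corollary 12, the case `n = 1`: `sxd(P_{1,2d}) = binom(1+d, 1) = d + 1`** — the
least block size `k` for which the cone of univariate nonnegative polynomials of degree `≤ 2d` has an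
`(S^k_+)^m`-lift for some `m` is `d + 1` (the case `d = 2`, `sxd(Σ_{1,4}) = 3`, is Averkov's Theorem 9 =
Ahmadi et al. / Fawzi). [cite: Averkov2019, Cor. 12 (p06), proof (p13); Cor. 4 and Thm. 9 (p05)] -/
theorem isLeast_blockSize_hasBlockPsdLift_nonnegPolynomialCone_univariate (d : ℕ) :
    IsLeast {k : ℕ | ∃ m : ℕ, HasBlockPsdLift (nonnegPolynomialCone 1 (2 * d) Set.univ) k m}
      (d + 1) := by
  have h := isLeast_blockSize_hasBlockPsdLift_sosPolynomialCone 1 d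
  rwa [sosPolynomialCone_univariate_eq_nonnegPolynomialCone, Nat.choose_one_right, add_comm] at h

/-- **Averkov 2019, Corollary 12, the case `n = 1`, one block: `sxc(P_{1,2d}) = d + 1`.**
[cite: Averkov2019, Cor. 12 (p06), proof (p13); Cor. 4 (p05)] -/
theorem isLeast_size_hasPsdLift_nonnegPolynomialCone_univariate (d : ℕ) :
    IsLeast {k : ℕ | HasPsdLift (nonnegPolynomialCone 1 (2 * d) Set.univ) k} (d + 1) := by
  have h := isLeast_size_hasPsdLift_sosPolynomialCone 1 d
  rwa [sosPolynomialCone_univariate_eq_nonnegPolynomialCone, Nat.choose_one_right, add_comm] at h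

end Literature.Combinatorics.Optimization
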